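import Summits.AtomisticToContinuum.FouriersLaw.Theorems.EmbeddedDrudeMourreAbelThermodynamicLimitAnchoredCorrelationTailsSiteTails
import Mathlib.Analysis.PSeries
import Mathlib.Data.Int.Interval

/-!
# Leaf (C) `stub_anchoredCorrelationTails`, part 4: the failure probability of the distance-growing boxes
(crux `EmbeddedDrudeMourre.AbelThermodynamicLimit`, item stmt-AtomisticToContinuum-12596, line
`loomis-compact-horizon-witness`; `--supports` file proving the registered sub-goal `stub_coneBadEvent`)

With `g_j = max(1, |j - i₀|/D)` the events `{∃ j, R² g_j/4 < q_j(0)²}` and `{∃ j, R² g_j/2 < 2t ∫₀ᵗ p_j(Φ_r)²}`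
(off which kinematics confines every position of the flow to its growing box on `[0, t]`) have probability
`O(D · R⁻¹⁶)` UNIFORMLY IN `N`: the one-site tails of part 3 are `∝ (R² g_j)⁻⁸ ≤ R⁻¹⁶ g_j⁻²`, and
`Σ_{j < N} g_j⁻² ≤ 7D` (`sum_coneWeight_sq_inv_le`: `2D+1` sites within distance `D`, `D² Σ_{n>D} n⁻² ≤ 2D` beyond on
each side, `sum_Ioo_inv_sq_le`).
-/

noncomputable section

namespace Summit.AtomisticToContinuum.FouriersLaw.Theorems.AbelThermodynamicLimit.LoomisCompactHorizonWitness

open MeasureTheory ProbabilityTheory Set Filter Topology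
open scoped NNReal ENNReal
open Literature.MathematicalPhysics.KineticTheory Literature.MathematicalPhysics.KineticTheory.HeatConduction
open Literature.Probability.Process OscillatorChain
open Summit.AtomisticToContinuum.FouriersLaw.Theorems.NonBallistic
open Summit.AtomisticToContinuum.FouriersLaw.Theorems.NonBallistic.LightConePropagation
open Summit.AtomisticToContinuum.FouriersLaw.Theorems.PhononMeanFreePath (commonPastBound_gibbsEvenMoments)
open Summit.AtomisticToContinuum.FouriersLaw.Theorems.SubdiffusiveBondHeat
open Summit.AtomisticToContinuum.FouriersLaw.Theorems.ChainVariation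

/-! ### §2.3 The lattice sum of the inverse squared weights -/

/-- **The inverse squared weights are summable over the chain, uniformly in `N`:**
`Σ_{j < N} (max(1, |j - i₀|/D))⁻² ≤ 7D` (`2D + 1` sites within distance `D`; beyond, `D² Σ_{n > D} n⁻² ≤ 2D` on
each side, `sum_Ioo_inv_sq_le`). [folklore] -/
theorem sum_coneWeight_sq_inv_le {N : ℕ} (i₀ : Fin N) {D : ℕ} (hD : 1 ≤ D) :
    ∑ j : Fin N, ((max (1:ℝ) ((((j : ℤ) - (i₀ : ℤ)).natAbs : ℝ) / D)) ^ 2)⁻¹ ≤ 7 * D := by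
  classical
  have hD0 : (0:ℝ) < D := by exact_mod_cast hD
  have hD1 : (1:ℝ) ≤ D := by exact_mod_cast hD
  set n : Fin N → ℕ := fun j => ((j : ℤ) - (i₀ : ℤ)).natAbs with hn
  -- the three pieces of the pointwise bound
  set A : Fin N → ℝ := fun j => if n j ≤ D then 1 else 0 with hA
  set B : Fin N → ℝ := fun j =>
    if D < n j ∧ i₀ < j then (D:ℝ) ^ 2 * (((j.val - i₀.val : ℕ) : ℝ) ^ 2)⁻¹ else 0 with hB
  set C : Fin N → ℝ := fun j =>
    if D < n j ∧ j < i₀ then (D:ℝ) ^ 2 * (((i₀.val - j.val : ℕ) : ℝ) ^ 2)⁻¹ else 0 with hC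
  have hB0 : ∀ j, 0 ≤ B j := fun j => by simp only [hB]; split_ifs <;> positivity
  have hC0 : ∀ j, 0 ≤ C j := fun j => by simp only [hC]; split_ifs <;> positivity
  have key : ∀ j : Fin N, ((max (1:ℝ) ((n j : ℝ) / D)) ^ 2)⁻¹ ≤ A j + (B j + C j) := by
    intro j
    by_cases hle : n j ≤ D
    · have h1 : (1:ℝ) ≤ (max (1:ℝ) ((n j : ℝ) / D)) ^ 2 := one_le_pow₀ (le_max_left _ _)
      have h2 : ((max (1:ℝ) ((n j : ℝ) / D)) ^ 2)⁻¹ ≤ 1 := inv_le_one_of_one_le₀ h1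
      have hA1 : A j = 1 := by simp only [hA, if_pos hle]
      linarith [hB0 j, hC0 j]
    · push Not at hle
      have hA0 : A j = 0 := by simp only [hA, if_neg (not_le.2 hle)]
      have hmax : max (1:ℝ) ((n j : ℝ) / D) = (n j : ℝ) / D :=
        max_eq_right (by rw [le_div_iff₀ hD0, one_mul]; exact_mod_cast hle.le)
      rw [hA0, zero_add, hmax]
      have hji : j ≠ i₀ := by
        intro h
        have : n j = 0 := by simp [hn, h]
        omega
      rcases lt_or_gt_of_ne hji with hlt | hgt
      · have hlt' : j.val < i₀.val := hlt
        have hnj : n j = i₀.val - j.val := by simp only [hn]; omega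
        have hBj : B j = 0 := by simp only [hB]; rw [if_neg (fun h => absurd h.2 (not_lt.2 hlt.le))]
        have hCj : C j = (D:ℝ) ^ 2 * (((i₀.val - j.val : ℕ) : ℝ) ^ 2)⁻¹ := by
          simp only [hC]; rw [if_pos ⟨hle, hlt⟩]
        rw [hBj, hCj, zero_add, hnj, div_pow, inv_div, div_eq_mul_inv]
      · have hgt' : i₀.val < j.val := hgt
        have hnj : n j = j.val - i₀.val := by simp only [hn]; omega
        have hCj : C j = 0 := by simp only [hC]; rw [if_neg (fun h => absurd h.2 (not_lt.2 hgt.le))]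
        have hBj : B j = (D:ℝ) ^ 2 * (((j.val - i₀.val : ℕ) : ℝ) ^ 2)⁻¹ := by
          simp only [hB]; rw [if_pos ⟨hle, hgt⟩]
        rw [hBj, hCj, add_zero, hnj, div_pow, inv_div, div_eq_mul_inv]
  -- piece A: at most `2D + 1` sites within distance `D`
  have hAsum : ∑ j, A j ≤ 2 * D + 1 := by
    simp only [hA, Finset.sum_boole]
    have hcard : (Finset.univ.filter fun j : Fin N => n j ≤ D).card ≤ (Finset.Icc (-(D:ℤ)) (D:ℤ)).card := by
      refine Finset.card_le_card_of_injOn (fun j : Fin N => (j : ℤ) - (i₀ : ℤ)) ?_ ?_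
      · intro j hj
        simp only [Finset.coe_filter, Finset.mem_univ, true_and, Set.mem_setOf_eq] at hj
        simp only [Finset.coe_Icc, Set.mem_Icc]
        simp only [hn] at hj
        omega
      · intro j _ j' _ h
        simp only at h
        exact Fin.ext (by omega)
    rw [Int.card_Icc] at hcard
    have e : ((D:ℤ) + 1 - -(D:ℤ)).toNat = 2 * D + 1 := by omega
    rw [e] at hcard
    exact_mod_cast hcard
  -- piece B: the sites to the right beyond distance `D`
  have hBsum : ∑ j, B j ≤ 2 * D := by
    set S := Finset.univ.filter fun j : Fin N => D < n j ∧ i₀ < j with hS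
    have e1 : ∑ j, B j = (D:ℝ) ^ 2 * ∑ j ∈ S, (((j.val - i₀.val : ℕ) : ℝ) ^ 2)⁻¹ := by
      rw [Finset.mul_sum, hS, Finset.sum_filter]
    set φ : Fin N → ℕ := fun j => j.val - i₀.val with hφ
    have hinj : ∀ j ∈ S, ∀ j' ∈ S, φ j = φ j' → j = j' := by
      intro j hj j' hj' h
      simp only [hS, Finset.mem_filter, Finset.mem_univ, true_and] at hj hj'
      have h1 : i₀.val < j.val := hj.2
      have h2 : i₀.val < j'.val := hj'.2
      simp only [hφ] at h
      exact Fin.ext (by omega)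
    have e2 : ∑ j ∈ S, (((j.val - i₀.val : ℕ) : ℝ) ^ 2)⁻¹ = ∑ m ∈ S.image φ, ((m : ℝ) ^ 2)⁻¹ :=
      (Finset.sum_image (f := fun m : ℕ => ((m : ℝ) ^ 2)⁻¹) hinj).symm
    have hsub : S.image φ ⊆ Finset.Ioo D N := by
      intro m hm
      simp only [Finset.mem_image] at hm
      obtain ⟨j, hj, rfl⟩ := hm
      simp only [hS, Finset.mem_filter, Finset.mem_univ, true_and] at hj
      have h1 : i₀.val < j.val := hj.2
      have h3 : D < n j := hj.1
      simp only [hn] at h3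
      simp only [Finset.mem_Ioo, hφ]
      omega
    have e3 : ∑ m ∈ S.image φ, ((m : ℝ) ^ 2)⁻¹ ≤ ∑ m ∈ Finset.Ioo D N, ((m : ℝ) ^ 2)⁻¹ :=
      Finset.sum_le_sum_of_subset_of_nonneg hsub fun m _ _ => by positivity
    have e4 : ∑ m ∈ Finset.Ioo D N, ((m : ℝ) ^ 2)⁻¹ ≤ 2 / (D + 1) := sum_Ioo_inv_sq_le D N
    rw [e1, e2]
    calc (D:ℝ) ^ 2 * ∑ m ∈ S.image φ, ((m : ℝ) ^ 2)⁻¹ ≤ (D:ℝ) ^ 2 * (2 / (D + 1)) :=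
          mul_le_mul_of_nonneg_left (e3.trans e4) (by positivity)
      _ ≤ 2 * D := by
          rw [mul_div_assoc', div_le_iff₀ (by positivity)]
          nlinarith
  -- piece C: the sites to the left beyond distance `D`
  have hCsum : ∑ j, C j ≤ 2 * D := by
    set S := Finset.univ.filter fun j : Fin N => D < n j ∧ j < i₀ with hS
    have e1 : ∑ j, C j = (D:ℝ) ^ 2 * ∑ j ∈ S, (((i₀.val - j.val : ℕ) : ℝ) ^ 2)⁻¹ := by
      rw [Finset.mul_sum, hS, Finset.sum_filter]
    set φ : Fin N → ℕ := fun j => i₀.val - j.val with hφ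
    have hinj : ∀ j ∈ S, ∀ j' ∈ S, φ j = φ j' → j = j' := by
      intro j hj j' hj' h
      simp only [hS, Finset.mem_filter, Finset.mem_univ, true_and] at hj hj'
      have h1 : j.val < i₀.val := hj.2
      have h2 : j'.val < i₀.val := hj'.2
      simp only [hφ] at h
      exact Fin.ext (by omega)
    have e2 : ∑ j ∈ S, (((i₀.val - j.val : ℕ) : ℝ) ^ 2)⁻¹ = ∑ m ∈ S.image φ, ((m : ℝ) ^ 2)⁻¹ :=
      (Finset.sum_image (f := fun m : ℕ => ((m : ℝ) ^ 2)⁻¹) hinj).symm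
    have hsub : S.image φ ⊆ Finset.Ioo D N := by
      intro m hm
      simp only [Finset.mem_image] at hm
      obtain ⟨j, hj, rfl⟩ := hm
      simp only [hS, Finset.mem_filter, Finset.mem_univ, true_and] at hj
      have h1 : j.val < i₀.val := hj.2
      have h3 : D < n j := hj.1
      have h4 := i₀.isLt
      simp only [hn] at h3
      simp only [Finset.mem_Ioo, hφ]
      omega
    have e3 : ∑ m ∈ S.image φ, ((m : ℝ) ^ 2)⁻¹ ≤ ∑ m ∈ Finset.Ioo D N, ((m : ℝ) ^ 2)⁻¹ :=
      Finset.sum_le_sum_of_subset_of_nonneg hsub fun m _ _ => by positivity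
    have e4 : ∑ m ∈ Finset.Ioo D N, ((m : ℝ) ^ 2)⁻¹ ≤ 2 / (D + 1) := sum_Ioo_inv_sq_le D N
    rw [e1, e2]
    calc (D:ℝ) ^ 2 * ∑ m ∈ S.image φ, ((m : ℝ) ^ 2)⁻¹ ≤ (D:ℝ) ^ 2 * (2 / (D + 1)) :=
          mul_le_mul_of_nonneg_left (e3.trans e4) (by positivity)
      _ ≤ 2 * D := by
          rw [mul_div_assoc', div_le_iff₀ (by positivity)]
          nlinarith
  calc ∑ j : Fin N, ((max (1:ℝ) ((n j : ℝ) / D)) ^ 2)⁻¹ ≤ ∑ j, (A j + (B j + C j)) :=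
        Finset.sum_le_sum fun j _ => key j
    _ = ∑ j, A j + (∑ j, B j + ∑ j, C j) := by rw [Finset.sum_add_distrib, Finset.sum_add_distrib]
    _ ≤ (2 * D + 1) + (2 * D + 2 * D) := add_le_add hAsum (add_le_add hBsum hCsum)
    _ ≤ 7 * D := by linarith

/-! ### §2.4 The failure probability of the distance-growing boxes -/

section BadEvent

variable {ω₂ lam β γ : ℝ} (hω : 0 < ω₂) (hl : 0 ≤ lam) (hβ : 0 ≤ β) (hγ : 0 ≤ γ) {N : ℕ} {T : ℝ} (hT : 0 < T)
include hω hl hβ hγ hT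

omit hγ in
/-- **Initial positions rarely leave the growing boxes**: with `g_j = max(1, |j - i₀|/D)`,
`μ_T {∃ j, R² g_j/4 < q_j²} ≤ 7D · κ₁₆ 4⁸/R¹⁶` uniformly in `N` (one-site tails `κ₁₆ (4/(R² g_j))⁸ ≤ κ₁₆ 4⁸ R⁻¹⁶ g_j⁻²`
summed with `sum_coneWeight_sq_inv_le`). [folklore] -/
theorem pinnedChain_gibbsMeasure_exists_sq_position_gt_le (i₀ : Fin N) {R : ℝ} (hR : 0 < R) {D : ℕ} (hD : 1 ≤ D) :
    (pinnedChain ω₂ lam β γ).gibbsMeasure N T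
        {x | ∃ j : Fin N, R ^ 2 * max 1 ((((j : ℤ) - (i₀ : ℤ)).natAbs : ℝ) / D) / 4 < x.1 j ^ 2} ≤
      ENNReal.ofReal (7 * D *
        (((∫⁻ a, ENNReal.ofReal (a ^ 16) * ENNReal.ofReal (Real.exp (-(pinnedChain ω₂ lam β γ).U a / T))) /
            ∫⁻ a, ENNReal.ofReal (Real.exp (-(pinnedChain ω₂ lam β γ).U a / T))).toReal * 4 ^ 8 / R ^ 16)) := by
  set P := pinnedChain ω₂ lam β γ with hP
  set μ := P.gibbsMeasure N T with hμ
  set κ := (∫⁻ a, ENNReal.ofReal (a ^ 16) * ENNReal.ofReal (Real.exp (-P.U a / T))) /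
    ∫⁻ a, ENNReal.ofReal (Real.exp (-P.U a / T)) with hκ
  have hκtop : κ ≠ ⊤ := (pinnedChain_lintegral_position_pow_sixteen_le hω hl hβ hT (N := N) i₀).2
  have hκ0 : 0 ≤ κ.toReal := ENNReal.toReal_nonneg
  set g : Fin N → ℝ := fun j => max 1 ((((j : ℤ) - (i₀ : ℤ)).natAbs : ℝ) / D) with hg
  have hg1 : ∀ j, 1 ≤ g j := fun j => le_max_left _ _
  have hg0 : ∀ j, 0 < g j := fun j => lt_of_lt_of_le one_pos (hg1 j)
  have hU : {x : PhaseSpace N | ∃ j : Fin N, R ^ 2 * g j / 4 < x.1 j ^ 2} = ⋃ j : Fin N, {x | R ^ 2 * g j / 4 < x.1 j ^ 2} := by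
    ext x; simp
  show μ {x : PhaseSpace N | ∃ j : Fin N, R ^ 2 * g j / 4 < x.1 j ^ 2} ≤ _
  rw [hU]
  have hj : ∀ j : Fin N, μ {x | R ^ 2 * g j / 4 < x.1 j ^ 2} ≤ ENNReal.ofReal (κ.toReal * 4 ^ 8 / R ^ 16 * (g j ^ 2)⁻¹) := by
    intro j
    have hb : 0 < R ^ 2 * g j / 4 := by have := hg0 j; positivity
    refine (pinnedChain_gibbsMeasure_sq_position_gt_le hω hl hβ hT j hb).trans ?_
    rw [← hκ]
    have e : κ / ENNReal.ofReal ((R ^ 2 * g j / 4) ^ 8) = ENNReal.ofReal (κ.toReal / (R ^ 2 * g j / 4) ^ 8) := by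
      rw [ENNReal.ofReal_div_of_pos (pow_pos hb 8), ENNReal.ofReal_toReal hκtop]
    rw [e]
    refine ENNReal.ofReal_le_ofReal ?_
    have hg8 : ((g j) ^ 8)⁻¹ ≤ ((g j) ^ 2)⁻¹ := by
      refine inv_anti₀ (by have := hg0 j; positivity) ?_
      exact pow_le_pow_right₀ (hg1 j) (by norm_num)
    have hgne : g j ≠ 0 := (hg0 j).ne'
    have hRne : R ≠ 0 := hR.ne'
    calc κ.toReal / (R ^ 2 * g j / 4) ^ 8 = κ.toReal * 4 ^ 8 / R ^ 16 * ((g j) ^ 8)⁻¹ := by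
          field_simp
      _ ≤ κ.toReal * 4 ^ 8 / R ^ 16 * ((g j) ^ 2)⁻¹ :=
          mul_le_mul_of_nonneg_left hg8 (by positivity)
  calc μ (⋃ j : Fin N, {x | R ^ 2 * g j / 4 < x.1 j ^ 2}) ≤ ∑ j : Fin N, μ {x | R ^ 2 * g j / 4 < x.1 j ^ 2} :=
        measure_iUnion_fintype_le _ _
    _ ≤ ∑ j : Fin N, ENNReal.ofReal (κ.toReal * 4 ^ 8 / R ^ 16 * (g j ^ 2)⁻¹) := Finset.sum_le_sum fun j _ => hj j
    _ = ENNReal.ofReal (∑ j : Fin N, κ.toReal * 4 ^ 8 / R ^ 16 * (g j ^ 2)⁻¹) :=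
        (ENNReal.ofReal_sum_of_nonneg fun j _ => by positivity).symm
    _ ≤ ENNReal.ofReal (7 * D * (κ.toReal * 4 ^ 8 / R ^ 16)) := by
        refine ENNReal.ofReal_le_ofReal ?_
        rw [← Finset.mul_sum]
        have hs := sum_coneWeight_sq_inv_le i₀ (N := N) hD
        calc κ.toReal * 4 ^ 8 / R ^ 16 * ∑ j : Fin N, (g j ^ 2)⁻¹ ≤ κ.toReal * 4 ^ 8 / R ^ 16 * (7 * D) :=
              mul_le_mul_of_nonneg_left hs (by positivity)
          _ = 7 * D * (κ.toReal * 4 ^ 8 / R ^ 16) := by ring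

/-- **Time-integrated momenta rarely leave the growing boxes**: with `g_j = max(1, |j - i₀|/D)` and `t ≥ 0`,
`(μ_T ⊗ W) {∃ j, R² g_j/2 < 2t ∫₀ᵗ p_j(Φ_r)² dr} ≤ 7D · 2027025 T⁸ 4⁸ t¹⁶ / R¹⁶` uniformly in `N`. [folklore] -/
theorem pinnedChain_prob_exists_timeIntegral_momentum_sq_gt_le (hN : 0 < N) (i₀ : Fin N) {R t : ℝ} (hR : 0 < R)
    (ht : 0 ≤ t) {D : ℕ} (hD : 1 ≤ D) :
    (((pinnedChain ω₂ lam β γ).gibbsMeasure N T).prod wienerPair)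
        {q | ∃ j : Fin N, R ^ 2 * max 1 ((((j : ℤ) - (i₀ : ℤ)).natAbs : ℝ) / D) / 2 <
          2 * t * ∫ r in (0:ℝ)..t, ((pinnedChain ω₂ lam β γ).solMap N T T r q.1 (pairPath q.2)).2 j ^ 2} ≤
      ENNReal.ofReal (7 * D * (2027025 * T ^ 8 * 4 ^ 8 * t ^ 16 / R ^ 16)) := by
  set P := pinnedChain ω₂ lam β γ with hP
  set π := (P.gibbsMeasure N T).prod wienerPair with hπ
  set g : Fin N → ℝ := fun j => max 1 ((((j : ℤ) - (i₀ : ℤ)).natAbs : ℝ) / D) with hg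
  have hg1 : ∀ j, 1 ≤ g j := fun j => le_max_left _ _
  have hg0 : ∀ j, 0 < g j := fun j => lt_of_lt_of_le one_pos (hg1 j)
  set X : Fin N → PhaseSpace N × WienerPair → ℝ := fun j q =>
    ∫ r in (0:ℝ)..t, (P.solMap N T T r q.1 (pairPath q.2)).2 j ^ 2 with hX
  show π {q | ∃ j : Fin N, R ^ 2 * g j / 2 < 2 * t * X j q} ≤ _
  rcases eq_or_lt_of_le ht with ht0 | htpos
  · -- `t = 0`: the event is empty
    have he : {q : PhaseSpace N × WienerPair | ∃ j : Fin N, R ^ 2 * g j / 2 < 2 * t * X j q} = ∅ := by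
      ext q
      simp only [Set.mem_setOf_eq, Set.mem_empty_iff_false, iff_false, not_exists, not_lt, ← ht0, mul_zero,
        zero_mul]
      intro j
      have := hg0 j
      positivity
    rw [he, measure_empty]
    exact bot_le
  have hU : {q : PhaseSpace N × WienerPair | ∃ j : Fin N, R ^ 2 * g j / 2 < 2 * t * X j q} =
      ⋃ j : Fin N, {q | R ^ 2 * g j / (4 * t) < X j q} := by
    ext q
    simp only [Set.mem_setOf_eq, Set.mem_iUnion]
    refine exists_congr fun j => ?_
    rw [div_lt_iff₀ (by positivity), div_lt_iff₀ (by positivity)]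
    constructor <;> intro h <;> nlinarith
  rw [hU]
  have hj : ∀ j : Fin N, π {q | R ^ 2 * g j / (4 * t) < X j q} ≤
      ENNReal.ofReal (2027025 * T ^ 8 * 4 ^ 8 * t ^ 16 / R ^ 16 * (g j ^ 2)⁻¹) := by
    intro j
    have ha : 0 < R ^ 2 * g j / (4 * t) := by have := hg0 j; positivity
    refine (pinnedChain_probSite_timeIntegral_momentum_sq_gt_eight hω hl hβ hγ N hN hT ht ha j).trans ?_
    refine ENNReal.ofReal_le_ofReal ?_
    have hg8 : ((g j) ^ 8)⁻¹ ≤ ((g j) ^ 2)⁻¹ := by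
      refine inv_anti₀ (by have := hg0 j; positivity) ?_
      exact pow_le_pow_right₀ (hg1 j) (by norm_num)
    have htne : t ≠ 0 := htpos.ne'
    have hgne : g j ≠ 0 := (hg0 j).ne'
    calc 2027025 * T ^ 8 * t ^ 8 / (R ^ 2 * g j / (4 * t)) ^ 8 =
          2027025 * T ^ 8 * 4 ^ 8 * t ^ 16 / R ^ 16 * ((g j) ^ 8)⁻¹ := by
          field_simp
      _ ≤ 2027025 * T ^ 8 * 4 ^ 8 * t ^ 16 / R ^ 16 * ((g j) ^ 2)⁻¹ :=
          mul_le_mul_of_nonneg_left hg8 (by positivity)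
  calc π (⋃ j : Fin N, {q | R ^ 2 * g j / (4 * t) < X j q}) ≤ ∑ j : Fin N, π {q | R ^ 2 * g j / (4 * t) < X j q} :=
        measure_iUnion_fintype_le _ _
    _ ≤ ∑ j : Fin N, ENNReal.ofReal (2027025 * T ^ 8 * 4 ^ 8 * t ^ 16 / R ^ 16 * (g j ^ 2)⁻¹) :=
        Finset.sum_le_sum fun j _ => hj j
    _ = ENNReal.ofReal (∑ j : Fin N, 2027025 * T ^ 8 * 4 ^ 8 * t ^ 16 / R ^ 16 * (g j ^ 2)⁻¹) :=
        (ENNReal.ofReal_sum_of_nonneg fun j _ => by positivity).symm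
    _ ≤ ENNReal.ofReal (7 * D * (2027025 * T ^ 8 * 4 ^ 8 * t ^ 16 / R ^ 16)) := by
        refine ENNReal.ofReal_le_ofReal ?_
        rw [← Finset.mul_sum]
        have hs := sum_coneWeight_sq_inv_le i₀ (N := N) hD
        calc 2027025 * T ^ 8 * 4 ^ 8 * t ^ 16 / R ^ 16 * ∑ j : Fin N, (g j ^ 2)⁻¹ ≤
            2027025 * T ^ 8 * 4 ^ 8 * t ^ 16 / R ^ 16 * (7 * D) := mul_le_mul_of_nonneg_left hs (by positivity)
          _ = 7 * D * (2027025 * T ^ 8 * 4 ^ 8 * t ^ 16 / R ^ 16) := by ring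

omit hT in
/-- The two events of the growing boxes are measurable. [folklore] -/
theorem measurableSet_coneBad (i₀ : Fin N) (R t : ℝ) (D : ℕ) :
    MeasurableSet {x : PhaseSpace N | ∃ j : Fin N,
        R ^ 2 * max 1 ((((j : ℤ) - (i₀ : ℤ)).natAbs : ℝ) / D) / 4 < x.1 j ^ 2} ∧
    MeasurableSet {q : PhaseSpace N × WienerPair | ∃ j : Fin N,
        R ^ 2 * max 1 ((((j : ℤ) - (i₀ : ℤ)).natAbs : ℝ) / D) / 2 <
          2 * t * ∫ r in (0:ℝ)..t, ((pinnedChain ω₂ lam β γ).solMap N T T r q.1 (pairPath q.2)).2 j ^ 2} := by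
  constructor
  · have e : {x : PhaseSpace N | ∃ j : Fin N, R ^ 2 * max 1 ((((j : ℤ) - (i₀ : ℤ)).natAbs : ℝ) / D) / 4 < x.1 j ^ 2} =
        ⋃ j : Fin N, {x | R ^ 2 * max 1 ((((j : ℤ) - (i₀ : ℤ)).natAbs : ℝ) / D) / 4 < x.1 j ^ 2} := by
      ext x; simp
    rw [e]
    exact MeasurableSet.iUnion fun j =>
      measurableSet_lt measurable_const (((measurable_pi_apply j).comp measurable_fst).pow_const 2)
  · have e : {q : PhaseSpace N × WienerPair | ∃ j : Fin N,
        R ^ 2 * max 1 ((((j : ℤ) - (i₀ : ℤ)).natAbs : ℝ) / D) / 2 <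
          2 * t * ∫ r in (0:ℝ)..t, ((pinnedChain ω₂ lam β γ).solMap N T T r q.1 (pairPath q.2)).2 j ^ 2} =
        ⋃ j : Fin N, {q | R ^ 2 * max 1 ((((j : ℤ) - (i₀ : ℤ)).natAbs : ℝ) / D) / 2 <
          2 * t * ∫ r in (0:ℝ)..t, ((pinnedChain ω₂ lam β γ).solMap N T T r q.1 (pairPath q.2)).2 j ^ 2} := by
      ext q; simp
    rw [e]
    exact MeasurableSet.iUnion fun j => measurableSet_lt measurable_const
      (measurable_const.mul (pinnedChain_measurable_timeIntegral_momentum_pow hω hl hβ hγ N T T t j 2))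

end BadEvent



/-- **Registered sub-goal `stub_coneBadEvent`** (leaf (C) of S4, line `loomis-compact-horizon-witness`): the
time-integrated momenta rarely leave the distance-growing boxes, uniformly in `N`
(`pinnedChain_prob_exists_timeIntegral_momentum_sq_gt_le`, closed form). [folklore] -/
theorem stub_coneBadEvent :
    ∀ ω₂ lam β γ : ℝ, 0 < ω₂ → 0 ≤ lam → 0 ≤ β → 0 ≤ γ → ∀ (N : ℕ), 0 < N → ∀ T : ℝ, 0 < T →
      ∀ (i₀ : Fin N) (R t : ℝ) (D : ℕ), 0 < R → 0 ≤ t → 1 ≤ D →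
        (((Literature.MathematicalPhysics.KineticTheory.HeatConduction.pinnedChain ω₂ lam β γ).gibbsMeasure N T).prod
            Literature.Probability.Process.wienerPair)
          {q | ∃ j : Fin N, R ^ 2 * max 1 ((((j : ℤ) - (i₀ : ℤ)).natAbs : ℝ) / D) / 2 <
            2 * t * ∫ r in (0:ℝ)..t, ((Literature.MathematicalPhysics.KineticTheory.HeatConduction.pinnedChain ω₂ lam β γ).solMap
              N T T r q.1 (Literature.Probability.Process.pairPath q.2)).2 j ^ 2} ≤
          ENNReal.ofReal (7 * D * (2027025 * T ^ 8 * 4 ^ 8 * t ^ 16 / R ^ 16)) :=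
  fun _ _ _ _ hω hl hβ hγ _ hN _ hT i₀ _ _ _ hR ht hD =>
    pinnedChain_prob_exists_timeIntegral_momentum_sq_gt_le hω hl hβ hγ hT hN i₀ hR ht hD

end Summit.AtomisticToContinuum.FouriersLaw.Theorems.AbelThermodynamicLimit.LoomisCompactHorizonWitness

end
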